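import Literature.RingTheory.CentralSimple.MaximalEtaleSubalgebra
import Literature.RingTheory.ZeroDimensional.FaithfulModuleDegreeBound
import Literature.RingTheory.SimpleModule.SemisimpleBaseChange
import Mathlib.Algebra.Algebra.Subalgebra.MulOpposite
import Mathlib.Algebra.Algebra.Subalgebra.Pi
import Mathlib.Algebra.Central.Matrix
import Mathlib.RingTheory.SimpleRing.Matrix
import Mathlib.LinearAlgebra.FiniteDimensional.Basic
import Mathlib.LinearAlgebra.Matrix.ToLin
import Mathlib.Order.Lattice.Nat
import HarnessLib

/-!
# The reduced degree `[B : F]_red` of a finite-dimensional algebra (Milne, *Complex Multiplication*, Ch. I (1.2)–(1.3))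

Family `hodge`, lane `lit-hodgefound` (Track 2 foundations library; skeleton seat `lit-hodgefound-skel-3`, generation 57,
row **A3-G141** «Milne CM Ch. I §1 (1.2)–(1.3), Props. 1.2–1.3; §3 Prop. 3.1, Def. 3.2, Prop. 3.3 (a)⟺(b) — the reduced
degree»), layer `Literature/RingTheory/CentralSimple`, namespace `Literature.RingTheory.CentralSimple`.  FILE 1 of the
row: the pure algebra (ONE definition with body, `reducedDegree`, and theorems; no instance, no notation, no named
fact — D-0026 net debt `0`).  FILE 2 (`AlgebraicGeometry/ComplexMultiplication/CMTypeReducedDegree`) reads it on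
`End⁰(A)` of a complex abelian variety.

## The print

J. S. Milne, *Complex Multiplication* (course notes v0.10, 2020) [MilneCM2006], Ch. I §1 p. 9 (open text
`paper:url-8ccc30e4daab`, p0009 L21–L47), VERBATIM: «Let `B` be a semisimple `k`-algebra, and let `B = ∏ Bᵢ` be its
decomposition into a product of simple algebras `Bᵢ`. The centre of each `Bᵢ` is a field `kᵢ`, and each degree
`[Bᵢ : kᵢ]` is a square. The *reduced degree* of `B` over `k` is defined to be
`[B : k]_red = Σᵢ [Bᵢ : kᵢ]^{1/2} [kᵢ : k]`. …  PROPOSITION 1.2 Let `B` be a semisimple `k`-algebra. For any faithful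
`B`-module `M`, `dim_k M ≥ [B : k]_red`, and there exists a faithful module for which equality holds if and only if the
simple factors of `B` are matrix algebras over their centres.  PROOF. Let `B = ∏ Bᵢ`, where `Bᵢ ≈ M_{nᵢ}(Dᵢ)` with `Dᵢ`
a central division algebra over `kᵢ`, and let `Sᵢ = Dᵢ^{nᵢ}` be a simple `Bᵢ`-module. Then every `B`-module `M` is
isomorphic to a sum `⊕ mᵢSᵢ`, and `M` is faithful if and only if each `mᵢ > 0`. Therefore, if `M` is faithful,
`dim_k M = Σᵢ mᵢnᵢ[Dᵢ:k][kᵢ:k] ≥ Σᵢ nᵢ[Dᵢ:k][kᵢ:k]`. On the other hand `[B:k]_red = Σᵢ nᵢ[Dᵢ:k]^{1/2}[kᵢ:k]`. The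
proposition is now obvious.  PROPOSITION 1.3 Let `B` be a semisimple `k`-algebra. Every maximal étale `k`-subalgebra
of `B` has degree `[B : k]_red` over `k`.  PROOF. When `B` is central simple, the proposition asserts that every maximal
subfield of `B` containing `k` has degree `[B : k]^{1/2}`. This case is proved in CFT, IV 3.5, and the general case
follows easily.»  And §3 p. 27 (p0027 L29–L40): «PROPOSITION 3.1 For any abelian variety `A`,
`2 dim A ≥ [End⁰(A) : ℚ]_red`. …  DEFINITION 3.2 A complex abelian variety `A` is said to have complex multiplication …
if `2 dim A = [End⁰(A) : ℚ]_red`.  PROPOSITION 3.3 … (a) `A` has complex multiplication; (b) `End⁰(A)` contains an étale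
subalgebra of degree `2 dim A` over `ℚ`; … PROOF. (a) ⟺ (b). According to (1.3), the degree of a maximal étale
subalgebra is `[End⁰(A):ℚ]_red`.»

## What is formalised

`F` a field, `B` a finite-dimensional `F`-algebra (in print `k`, resp. `ℚ`).  «Étale subalgebra» is carried, as in every
CM file of the tree (`Milne1999.IsOfCMType`, `CMAlgebraTorusCommutativeSubalgebra`, A3-G140), as «commutative REDUCED
subalgebra» (over a perfect field — Milne's fields have characteristic `0` — étale = commutative semisimple =
commutative reduced for finite-dimensional algebras; separability is never used below).

* §1 **DEFINITION** `reducedDegree F B : ℕ` — the reduced degree `[B : F]_red`, defined INTRINSICALLY (no Wedderburn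
  decomposition is chosen) as the largest `F`-dimension of a commutative reduced `F`-subalgebra of `B`; by Prop. 1.3
  (every maximal étale subalgebra has degree `[B:k]_red`) this is Milne's number, and §6–§7 PROVE Milne's printed
  formula `[B : F]_red = Σᵢ [Bᵢ : kᵢ]^{1/2} [kᵢ : F]` for every decomposition `B ≃ ∏ Bᵢ` into simple algebras with
  centres `kᵢ` (characteristic `0`).  API: the bound is attained (`exists_finrank_eq_reducedDegree`) and is an upper
  bound (`finrank_le_reducedDegree`) — PROP. 1.3 in «max» form; `reducedDegree_le_iff`, `reducedDegree_eq_iff`,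
  **`reducedDegree_eq_iff_exists_of_le`** (given `[B:F]_red ≤ m`: `[B:F]_red = m` iff `B` has a commutative reduced
  subalgebra of dimension `m` — the abstract form of PROP. 3.3 (a) ⟺ (b)); `1 ≤ [B:F]_red ≤ [B:F]`; a subalgebra of
  dimension `[B:F]_red` is MAXIMAL among commutative reduced subalgebras (`maximal_of_finrank_eq_reducedDegree`; the
  converse — every inclusion-maximal étale subalgebra has degree `[B:F]_red`, Bourbaki VIII §14 n°7 Prop. 4 — is the
  `TODO(general form)` recorded in the tree's `MaximalEtaleSubalgebra`, not needed for 3.1–3.3).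
* §2 transport: monotone along injective algebra maps (`reducedDegree_le_of_injective`), invariant under `≃ₐ`
  (`reducedDegree_eq_of_algEquiv`) and under passing to `Bᵐᵒᵖ` (`reducedDegree_mulOpposite`).
* §3 **PROP. 1.2, first clause** — `reducedDegree_le_finrank_of_faithful`: for every FAITHFUL `B`-module `M`,
  finite-dimensional over `F`, `[B : F]_red ≤ dim_F M` (Shimura's count, the tree's
  `ZeroDimensional.finrank_le_finrank_of_faithful`, applied to a commutative reduced `L ⊆ B` of maximal dimension, which
  acts faithfully on `M`); forms for a faithful representation `B →ₐ End_F V` / `B →ₐ (End_F V)ᵐᵒᵖ` and for subalgebras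
  of `End_F V`.  (The equality clause of Prop. 1.2 is not in this file.)
* §4 products and commutative algebras: `reducedDegree_pi` (`[∏ Bᵢ : F]_red = Σ [Bᵢ : F]_red` — the additivity in
  Milne's formula), `reducedDegree_eq_finrank_of_comm` (`B` commutative reduced ⟹ `[B:F]_red = [B:F]`; in particular
  `[K:F]_red = [K:F]` for a field `K ⊇ F`).
* §5 **central simple algebras** (any `F`): `reducedDegree_eq_of_isCentral_isSimple` — `[B:F] = d²` ⟹ `[B:F]_red = d`
  («each degree `[Bᵢ:kᵢ]` is a square … `[Bᵢ:kᵢ]^{1/2}`»; Prop. 1.3's central simple case «every maximal subfield … has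
  degree `[B:k]^{1/2}`» in max form), by the tree's Bourbaki VIII §14 n°6 Prop. 3 bound
  `CentralSimple.finrank_le_of_finrank_eq_sq` and n°7 existence `exists_isSeparable_comm_finrank_sq_eq` (p38); hence
  `reducedDegree_matrix` (`[M_n(F):F]_red = n`) and `reducedDegree_moduleEnd` (`[End_F V : F]_red = dim V`).
* §6 **simple algebras with a bigger centre** (`F` of characteristic `0`, `B` central simple over a field `K ⊇ F`,
  `[B:K] = d²`): `reducedDegree_eq_mul_of_isCentral_isSimple` — `[B:F]_red = d·[K:F]` (= `[Bᵢ:kᵢ]^{1/2}[kᵢ:k]`).  The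
  upper bound pushes a commutative reduced `F`-subalgebra `L` to the `K`-subalgebra `K·L`, the image of `K ⊗_F L`, which
  is semisimple by the tree's Pierce §10.7 `SimpleModule.isSemisimpleRing_baseChange` (this is where characteristic `0`
  enters), and applies §5 over `K`.
  -- TODO(general form): drop `[CharZero F]` in §6–§7 (the statement holds for every field `F`; for an inseparable
  -- centre `K/F` the compositum `K·L` can fail to be reduced and one needs the residue fields of `K ⊗_F L` instead).
* §7 **MILNE'S FORMULA** as a theorem: `reducedDegree_eq_sum_of_algEquiv_pi` — for `e : B ≃ₐ[F] ∏ᵢ Bᵢ` with `Bᵢ`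
  central simple over fields `Kᵢ ⊇ F`, `[Bᵢ:Kᵢ] = dᵢ²`: `[B:F]_red = Σᵢ dᵢ[Kᵢ:F]`; and in Wedderburn's shape
  `reducedDegree_eq_sum_of_algEquiv_pi_matrix` — for `e : B ≃ₐ[F] ∏ᵢ M_{nᵢ}(Dᵢ)`, `Dᵢ` central division algebras over
  `Kᵢ` with `[Dᵢ:Kᵢ] = δᵢ²`: `[B:F]_red = Σᵢ nᵢδᵢ[Kᵢ:F]` («`[B:k]_red = Σᵢ nᵢ[Dᵢ:k]^{1/2}[kᵢ:k]`» — Milne's `[Dᵢ:k]`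
  there means `[Dᵢ:kᵢ]`).

## Mathlib / Literature search

Mathlib: no reduced degree (`rg -i 'reduced degree|reducedDegree' Mathlib` → 0); used: Wedderburn–Artin shapes only
through the hypotheses of §7, `Algebra.IsCentral.matrix`, `IsSimpleRing.matrix`, `Subalgebra.pi`, `Subalgebra.op`,
`Nat.sSup_mem`.  Tree: `rg -i 'reduced.?degree' lean/Literature` → only the Schur-index / simple-`E_φ` index forms
(`Geometry/Kaehler/ComplexTorusGroupAlgebraSchurIndex.exists_reducedDegree`,
`Motives/HodgeStructureSimpleEndAlgIndexDvdHodgeNumbers.index_*_of_isSimpleRing`), no notion for a semisimple algebra;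
consumed BY NAME: `CentralSimple.finrank_le_of_finrank_eq_sq`, `CentralSimple.exists_isSeparable_comm_finrank_sq_eq`
(Bourbaki VIII §14, p38 g42-#8 / g43-#5), `ZeroDimensional.finrank_le_finrank_of_faithful` (Shimura 1998 §5.1 Prop. 1),
`SimpleModule.isSemisimpleRing_baseChange` (Pierce 1982 §10.7).

## References

* [MilneCM2006] J. S. Milne, *Complex Multiplication* (2006/2020), Ch. I §1 (1.2)–(1.3), Props. 1.2, 1.3 (p. 9); §3
  Prop. 3.1, Def. 3.2, Prop. 3.3 (p. 27).
* [BourbakiAlgebreVIII2012] N. Bourbaki, *Algèbre* Ch. VIII (2012), §14 n°6 Prop. 3, n°7 Prop. 4 and Cor. 1.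
* [Shimura1998] G. Shimura, *Abelian Varieties with Complex Multiplication and Modular Functions* (1998), §5.1 Prop. 1.
* [Pierce1982] R. S. Pierce, *Associative Algebras* (1982), §10.7 Cor. b.
-/

noncomputable section

open Module
open scoped TensorProduct

namespace Literature.RingTheory.CentralSimple

universe u v w

/-! ## §0 Reduced subalgebras, elementwise -/

section Helpers

variable {R : Type*} [CommSemiring R] {A : Type*} [Semiring A] [Algebra R A]

/-- A subalgebra is reduced iff it contains no non-zero nilpotent element of the ambient algebra. [folklore] -/
private theorem isReduced_subalgebra_iff (S : Subalgebra R A) :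
    IsReduced S ↔ ∀ x ∈ S, IsNilpotent x → x = 0 := by
  constructor
  · rintro h x hx ⟨n, hn⟩
    have h0 : (⟨x, hx⟩ : S) = 0 :=
      h.eq_zero _ ⟨n, Subtype.ext (by rw [SubmonoidClass.coe_pow, ZeroMemClass.coe_zero]; exact hn)⟩
    exact congrArg Subtype.val h0
  · intro h
    refine ⟨fun x hx => ?_⟩
    obtain ⟨n, hn⟩ := hx
    have h1 : (x : A) ^ n = 0 := by rw [← SubmonoidClass.coe_pow, hn, ZeroMemClass.coe_zero]
    exact Subtype.ext (by rw [ZeroMemClass.coe_zero]; exact h x x.2 ⟨n, h1⟩)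

/-- A subalgebra contained in a reduced subalgebra is reduced. [folklore] -/
private theorem isReduced_of_le {S T : Subalgebra R A} (h : S ≤ T) [hT : IsReduced T] : IsReduced S := by
  rw [isReduced_subalgebra_iff] at hT ⊢
  exact fun x hx hn => hT x (h hx) hn

end Helpers

/-! ## §1 The definition and its order-theoretic API (Prop. 1.3 in max form) -/

section Definition

variable (F : Type u) [Field F] (B : Type v) [Ring B] [Algebra F B]

/-- **The reduced degree `[B : F]_red`** of an `F`-algebra `B` (Milne CM Ch. I (1.2): for `B = ∏ Bᵢ` semisimple with
simple factors `Bᵢ` of centres `kᵢ`, `[B : k]_red = Σᵢ [Bᵢ : kᵢ]^{1/2} [kᵢ : k]`), defined intrinsically as the largest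
`F`-dimension of a commutative reduced (= étale, in characteristic `0`) `F`-subalgebra of `B`; that this is Milne's
number is his Prop. 1.3 («Every maximal étale `k`-subalgebra of `B` has degree `[B : k]_red` over `k`»), and the printed
formula is the theorem `reducedDegree_eq_sum_of_algEquiv_pi` below.
[cite: MilneCM2006, Ch. I §1 (1.2)–(1.3) and Prop. 1.3 (p. 9)] -/
def reducedDegree : ℕ :=
  sSup {n : ℕ | ∃ L : Subalgebra F B, (∀ x ∈ L, ∀ y ∈ L, x * y = y * x) ∧ IsReduced L ∧ finrank F L = n}

variable {F B}

/-- Unfolding of `reducedDegree`. [cite: MilneCM2006, Ch. I §1 (1.2) (p. 9)] -/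
theorem reducedDegree_def :
    reducedDegree F B =
      sSup {n : ℕ | ∃ L : Subalgebra F B, (∀ x ∈ L, ∀ y ∈ L, x * y = y * x) ∧ IsReduced L ∧ finrank F L = n} :=
  rfl

/-- `F·1 ⊆ B` is reduced (a field has no nilpotents; if `B = 0` there is nothing to prove). [folklore] -/
private theorem isReduced_bot : IsReduced (⊥ : Subalgebra F B) := by
  rw [isReduced_subalgebra_iff]
  intro x hx hnil
  obtain ⟨c, rfl⟩ := Algebra.mem_bot.1 hx
  rcases subsingleton_or_nontrivial B with hB | hB
  · exact Subsingleton.elim _ _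
  · obtain ⟨n, hn⟩ := hnil
    have hc : c ^ n = 0 := (algebraMap F B).injective (by rw [map_pow, hn, map_zero])
    rw [pow_eq_zero_iff'] at hc
    rw [hc.1, map_zero]

/-- `F·1 ⊆ B` is commutative. [folklore] -/
private theorem comm_bot : ∀ x ∈ (⊥ : Subalgebra F B), ∀ y ∈ (⊥ : Subalgebra F B), x * y = y * x := by
  intro x hx y _
  obtain ⟨c, rfl⟩ := Algebra.mem_bot.1 hx
  exact Algebra.commutes c y

/-- The set of dimensions of commutative reduced subalgebras is non-empty (`F·1`), so `[B : F]_red` is well defined. [cite: MilneCM2006, Ch. I §1 (1.2) (p. 9)] -/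
theorem nonempty_setOf_reducedDegree :
    {n : ℕ | ∃ L : Subalgebra F B, (∀ x ∈ L, ∀ y ∈ L, x * y = y * x) ∧ IsReduced L ∧ finrank F L = n}.Nonempty :=
  ⟨_, ⊥, comm_bot, isReduced_bot, rfl⟩

/-- … and bounded by `[B : F]`, so `[B : F]_red` is well defined. [cite: MilneCM2006, Ch. I §1 (1.2) (p. 9)] -/
theorem bddAbove_setOf_reducedDegree [FiniteDimensional F B] :
    BddAbove {n : ℕ | ∃ L : Subalgebra F B, (∀ x ∈ L, ∀ y ∈ L, x * y = y * x) ∧ IsReduced L ∧ finrank F L = n} := by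
  refine ⟨finrank F B, ?_⟩
  rintro n ⟨L, -, -, rfl⟩
  rw [← Subalgebra.finrank_toSubmodule]
  exact Submodule.finrank_le _

/-- **Prop. 1.3, upper bound: every commutative reduced (étale) subalgebra has dimension `≤ [B : F]_red`.**
[cite: MilneCM2006, Ch. I §1 Prop. 1.3 (p. 9)] -/
theorem finrank_le_reducedDegree [FiniteDimensional F B] (L : Subalgebra F B)
    (hcomm : ∀ x ∈ L, ∀ y ∈ L, x * y = y * x) [hL : IsReduced L] : finrank F L ≤ reducedDegree F B :=
  le_csSup bddAbove_setOf_reducedDegree ⟨L, hcomm, hL, rfl⟩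

/-- **Prop. 1.3, attainment: `B` has a commutative reduced (étale) subalgebra of dimension exactly `[B : F]_red`.**
[cite: MilneCM2006, Ch. I §1 Prop. 1.3 (p. 9)] -/
theorem exists_finrank_eq_reducedDegree [FiniteDimensional F B] :
    ∃ L : Subalgebra F B, (∀ x ∈ L, ∀ y ∈ L, x * y = y * x) ∧ IsReduced L ∧ finrank F L = reducedDegree F B :=
  Nat.sSup_mem nonempty_setOf_reducedDegree bddAbove_setOf_reducedDegree

/-- `[B : F]_red ≤ m` iff every commutative reduced subalgebra has dimension `≤ m`. [cite: MilneCM2006, Ch. I §1 (1.2)–(1.3) (p. 9)] -/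
theorem reducedDegree_le_iff [FiniteDimensional F B] {m : ℕ} :
    reducedDegree F B ≤ m ↔
      ∀ L : Subalgebra F B, (∀ x ∈ L, ∀ y ∈ L, x * y = y * x) → IsReduced L → finrank F L ≤ m := by
  constructor
  · intro h L hcomm hred
    exact (finrank_le_reducedDegree L hcomm).trans h
  · intro h
    refine csSup_le nonempty_setOf_reducedDegree ?_
    rintro n ⟨L, hcomm, hred, rfl⟩
    exact h L hcomm hred

/-- `m ≤ [B : F]_red` iff some commutative reduced subalgebra has dimension `≥ m`. [cite: MilneCM2006, Ch. I §1 (1.2)–(1.3) (p. 9)] -/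
theorem le_reducedDegree_iff [FiniteDimensional F B] {m : ℕ} :
    m ≤ reducedDegree F B ↔
      ∃ L : Subalgebra F B, (∀ x ∈ L, ∀ y ∈ L, x * y = y * x) ∧ IsReduced L ∧ m ≤ finrank F L := by
  constructor
  · intro h
    obtain ⟨L, hcomm, hred, hL⟩ := exists_finrank_eq_reducedDegree (F := F) (B := B)
    exact ⟨L, hcomm, hred, hL ▸ h⟩
  · rintro ⟨L, hcomm, hred, hL⟩
    exact hL.trans (finrank_le_reducedDegree L hcomm)

/-- `[B : F]_red = m` iff `m` is attained by and bounds the dimensions of commutative reduced subalgebras.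
[cite: MilneCM2006, Ch. I §1 (1.2)–(1.3) (p. 9)] -/
theorem reducedDegree_eq_iff [FiniteDimensional F B] {m : ℕ} :
    reducedDegree F B = m ↔
      (∃ L : Subalgebra F B, (∀ x ∈ L, ∀ y ∈ L, x * y = y * x) ∧ IsReduced L ∧ finrank F L = m) ∧
        ∀ L : Subalgebra F B, (∀ x ∈ L, ∀ y ∈ L, x * y = y * x) → IsReduced L → finrank F L ≤ m := by
  constructor
  · rintro rfl
    exact ⟨exists_finrank_eq_reducedDegree, fun L hcomm hred => finrank_le_reducedDegree L hcomm⟩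
  · rintro ⟨⟨L, hcomm, hred, hL⟩, h⟩
    exact le_antisymm (reducedDegree_le_iff.2 h) (hL ▸ finrank_le_reducedDegree L hcomm)

/-- **The abstract form of Prop. 3.3 (a) ⟺ (b)**: once `[B : F]_red ≤ m` is known (Prop. 3.1: `m = 2 dim A`),
`[B : F]_red = m` iff `B` contains a commutative reduced (étale) subalgebra of dimension `m`.
[cite: MilneCM2006, Ch. I §3 Prop. 3.3 (a)⟺(b) (pp. 27–28)] -/
theorem reducedDegree_eq_iff_exists_of_le [FiniteDimensional F B] {m : ℕ} (hle : reducedDegree F B ≤ m) :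
    reducedDegree F B = m ↔
      ∃ L : Subalgebra F B, (∀ x ∈ L, ∀ y ∈ L, x * y = y * x) ∧ IsReduced L ∧ finrank F L = m := by
  constructor
  · rintro rfl
    exact exists_finrank_eq_reducedDegree
  · rintro ⟨L, hcomm, hred, hL⟩
    exact le_antisymm hle (hL ▸ finrank_le_reducedDegree L hcomm)

/-- `[B : F]_red ≤ [B : F]`. [cite: MilneCM2006, Ch. I §1 (1.2) (p. 9)] -/
theorem reducedDegree_le_finrank [FiniteDimensional F B] : reducedDegree F B ≤ finrank F B := by
  refine reducedDegree_le_iff.2 fun L _ _ => ?_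
  rw [← Subalgebra.finrank_toSubmodule]
  exact Submodule.finrank_le _

/-- `1 ≤ [B : F]_red` for `B ≠ 0` (`F·1` is a commutative reduced subalgebra of dimension `1`). [cite: MilneCM2006, Ch. I §1 (1.2) (p. 9)] -/
theorem one_le_reducedDegree [FiniteDimensional F B] [Nontrivial B] : 1 ≤ reducedDegree F B := by
  haveI := isReduced_bot (F := F) (B := B)
  have h := finrank_le_reducedDegree (⊥ : Subalgebra F B) comm_bot
  rwa [Subalgebra.finrank_bot] at h

/-- `[0 : F]_red = 0` (the empty product of simple algebras). [cite: MilneCM2006, Ch. I §1 (1.2) (p. 9)] -/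
theorem reducedDegree_eq_zero_of_subsingleton [Subsingleton B] : reducedDegree F B = 0 := by
  haveI : FiniteDimensional F B := Module.Finite.of_surjective (0 : F →ₗ[F] B) fun x => ⟨0, Subsingleton.elim _ _⟩
  have h := reducedDegree_le_finrank (F := F) (B := B)
  rw [Module.finrank_zero_of_subsingleton] at h
  exact Nat.le_zero.1 h

/-- **A commutative reduced subalgebra of dimension `[B : F]_red` is MAXIMAL among commutative reduced subalgebras**
(dimension-maximal ⟹ inclusion-maximal; the converse is Bourbaki VIII §14 n°7 Prop. 4).
[cite: MilneCM2006, Ch. I §1 Prop. 1.3 (p. 9)] [cite: BourbakiAlgebreVIII2012, VIII §14 n°7 Prop. 4] -/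
theorem maximal_of_finrank_eq_reducedDegree [FiniteDimensional F B] (L : Subalgebra F B)
    (hcomm : ∀ x ∈ L, ∀ y ∈ L, x * y = y * x) [IsReduced L] (hL : finrank F L = reducedDegree F B) :
    Maximal (fun M : Subalgebra F B => (∀ x ∈ M, ∀ y ∈ M, x * y = y * x) ∧ IsReduced M) L := by
  refine ⟨⟨hcomm, ‹_›⟩, fun M hM hLM => ?_⟩
  haveI := hM.2
  have h1 : finrank F M ≤ finrank F L := hL ▸ finrank_le_reducedDegree M hM.1
  have h2 : finrank F L ≤ finrank F M := by
    rw [← Subalgebra.finrank_toSubmodule, ← Subalgebra.finrank_toSubmodule]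
    exact Submodule.finrank_mono (show Subalgebra.toSubmodule L ≤ Subalgebra.toSubmodule M from fun x hx => hLM hx)
  exact (Subalgebra.eq_of_le_of_finrank_eq hLM (le_antisymm h2 h1)).ge

end Definition

/-! ## §2 Transport: injective maps, isomorphisms, the opposite algebra -/

section Transport

variable {F : Type u} [Field F] {B : Type v} [Ring B] [Algebra F B] {B' : Type w} [Ring B'] [Algebra F B']

/-- The image of a commutative reduced subalgebra under an injective algebra map is commutative, reduced, of the same
dimension. [folklore] -/
private theorem exists_map_of_injective (f : B →ₐ[F] B') (hf : Function.Injective f) (L : Subalgebra F B)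
    (hcomm : ∀ x ∈ L, ∀ y ∈ L, x * y = y * x) [hred : IsReduced L] :
    (∀ x ∈ L.map f, ∀ y ∈ L.map f, x * y = y * x) ∧ IsReduced ↥(L.map f) ∧ finrank F ↥(L.map f) = finrank F L := by
  let ψ := Subalgebra.equivMapOfInjective L f hf
  refine ⟨?_, isReduced_of_injective ψ.symm ψ.symm.injective, ψ.symm.toLinearEquiv.finrank_eq⟩
  rintro _ ⟨a, ha, rfl⟩ _ ⟨b, hb, rfl⟩
  rw [← map_mul, ← map_mul, hcomm a ha b hb]

/-- **`[B : F]_red` is monotone along injective algebra homomorphisms.** [cite: MilneCM2006, Ch. I §1 (1.2)–(1.3) (p. 9)] -/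
theorem reducedDegree_le_of_injective [FiniteDimensional F B'] (f : B →ₐ[F] B') (hf : Function.Injective f) :
    reducedDegree F B ≤ reducedDegree F B' := by
  refine csSup_le nonempty_setOf_reducedDegree ?_
  rintro n ⟨L, hcomm, hred, rfl⟩
  obtain ⟨hcomm', hred', hdim⟩ := exists_map_of_injective f hf L hcomm
  haveI := hred'
  rw [← hdim]
  exact finrank_le_reducedDegree (L.map f) hcomm'

/-- **`[B : F]_red` is invariant under algebra isomorphisms.** [cite: MilneCM2006, Ch. I §1 (1.2)–(1.3) (p. 9)] -/
theorem reducedDegree_eq_of_algEquiv [FiniteDimensional F B] (e : B ≃ₐ[F] B') :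
    reducedDegree F B = reducedDegree F B' := by
  haveI : FiniteDimensional F B' := Module.Finite.equiv e.toLinearEquiv
  exact le_antisymm (reducedDegree_le_of_injective (e : B →ₐ[F] B') e.injective)
    (reducedDegree_le_of_injective (e.symm : B' →ₐ[F] B) e.symm.injective)

/-- A subalgebra has reduced degree at most that of the ambient algebra. [cite: MilneCM2006, Ch. I §1 (1.2)–(1.3) (p. 9)] -/
theorem reducedDegree_subalgebra_le [FiniteDimensional F B] (R : Subalgebra F B) :
    reducedDegree F R ≤ reducedDegree F B :=
  reducedDegree_le_of_injective R.val Subtype.val_injective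

/-- The opposite `Sᵒ ⊆ Bᵐᵒᵖ` of a commutative reduced subalgebra: same properties, same dimension. [folklore] -/
private theorem exists_comm_isReduced_op_iff (n : ℕ) :
    (∃ S : Subalgebra F Bᵐᵒᵖ, (∀ x ∈ S, ∀ y ∈ S, x * y = y * x) ∧ IsReduced S ∧ finrank F S = n) ↔
      ∃ S : Subalgebra F B, (∀ x ∈ S, ∀ y ∈ S, x * y = y * x) ∧ IsReduced S ∧ finrank F S = n := by
  constructor
  · rintro ⟨S, hcomm, hred, hdim⟩
    refine ⟨S.unop, ?_, ?_, ?_⟩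
    · intro x hx y hy
      apply MulOpposite.op_injective
      rw [MulOpposite.op_mul, MulOpposite.op_mul]
      exact (hcomm _ (Subalgebra.mem_unop.1 hx) _ (Subalgebra.mem_unop.1 hy)).symm
    · rw [isReduced_subalgebra_iff] at hred ⊢
      intro x hx hn
      obtain ⟨n, hn⟩ := hn
      exact (MulOpposite.op_eq_zero_iff _).1
        (hred _ (Subalgebra.mem_unop.1 hx) ⟨n, by rw [← MulOpposite.op_pow, hn, MulOpposite.op_zero]⟩)
    · rw [← hdim]
      exact (S.unop.linearEquivOp).finrank_eq
  · rintro ⟨S, hcomm, hred, hdim⟩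
    refine ⟨S.op, ?_, ?_, ?_⟩
    · intro x hx y hy
      apply MulOpposite.unop_injective
      rw [MulOpposite.unop_mul, MulOpposite.unop_mul]
      exact (hcomm _ (Subalgebra.mem_op.1 hx) _ (Subalgebra.mem_op.1 hy)).symm
    · rw [isReduced_subalgebra_iff] at hred ⊢
      intro x hx hn
      obtain ⟨n, hn⟩ := hn
      exact (MulOpposite.unop_eq_zero_iff _).1
        (hred _ (Subalgebra.mem_op.1 hx) ⟨n, by rw [← MulOpposite.unop_pow, hn, MulOpposite.unop_zero]⟩)
    · rw [← hdim]
      exact (S.linearEquivOp).finrank_eq.symm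

/-- **`[Bᵐᵒᵖ : F]_red = [B : F]_red`.** [cite: MilneCM2006, Ch. I §1 (1.2)–(1.3) (p. 9)] -/
theorem reducedDegree_mulOpposite : reducedDegree F Bᵐᵒᵖ = reducedDegree F B := by
  rw [reducedDegree_def, reducedDegree_def]
  congr 1
  ext n
  exact exists_comm_isReduced_op_iff n

end Transport

/-! ## §3 Prop. 1.2 (first clause): faithful modules bound the reduced degree -/

section Faithful

variable {F : Type u} [Field F] {B : Type v} [Ring B] [Algebra F B] [FiniteDimensional F B]

/-- **MILNE CM PROP. 1.2 (first clause): for every faithful `B`-module `M`, `dim_F M ≥ [B : F]_red`.**  A commutative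
reduced `L ⊆ B` of dimension `[B:F]_red` acts faithfully on `M`, so `dim_F M ≥ dim_F L` by Shimura's count (the tree's
`ZeroDimensional.finrank_le_finrank_of_faithful`: «`Σ mᵢdᵢ ≥ Σ dᵢ`»).
[cite: MilneCM2006, Ch. I §1 Prop. 1.2 (p. 9)] [cite: Shimura1998, §5.1 Prop. 1 (proof)] -/
theorem reducedDegree_le_finrank_of_faithful {M : Type*} [AddCommGroup M] [Module F M] [Module B M]
    [IsScalarTower F B M] [FiniteDimensional F M] (hM : ∀ b : B, (∀ m : M, b • m = 0) → b = 0) :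
    reducedDegree F B ≤ finrank F M := by
  refine reducedDegree_le_iff.2 fun L hcomm hred => ?_
  letI : CommRing L := { (inferInstance : Ring L) with mul_comm := fun x y => Subtype.ext (hcomm x x.2 y y.2) }
  haveI : Module.Finite F L := inferInstance
  haveI : IsArtinianRing L := IsArtinianRing.of_finite F L
  -- the action of `L` on `M` through `L ⊆ B`
  let φ : L →+* B :=
    { toFun := fun s => (s : B)
      map_one' := rfl
      map_mul' := fun _ _ => rfl
      map_zero' := rfl
      map_add' := fun _ _ => rfl }
  letI : Module L M := Module.compHom M φ
  haveI : IsScalarTower F L M := ⟨fun c x m => by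
    change ((c • x : L) : B) • m = c • ((x : B) • m)
    rw [Subalgebra.coe_smul, smul_assoc]⟩
  exact ZeroDimensional.finrank_le_finrank_of_faithful (F := F) (S := L) (V := M) fun s hs =>
    Subtype.ext (hM (s : B) hs)

/-- **Prop. 1.2 for a faithful representation `ρ : B ↪ End_F(V)`: `[B : F]_red ≤ dim_F V`.**
[cite: MilneCM2006, Ch. I §1 Prop. 1.2 (p. 9)] -/
theorem reducedDegree_le_finrank_of_injective_toEnd {V : Type*} [AddCommGroup V] [Module F V]
    [FiniteDimensional F V] (ρ : B →ₐ[F] Module.End F V) (hρ : Function.Injective ρ) :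
    reducedDegree F B ≤ finrank F V := by
  letI : Module B V := Module.compHom V (ρ : B →+* Module.End F V)
  haveI : IsScalarTower F B V := ⟨fun c b v => by
    change ρ (c • b) v = c • ρ b v
    rw [map_smul, LinearMap.smul_apply]⟩
  refine reducedDegree_le_finrank_of_faithful fun b hb => hρ ?_
  rw [map_zero]
  exact LinearMap.ext hb

/-- **Prop. 1.2 for a faithful anti-representation `ρ : B ↪ End_F(V)ᵐᵒᵖ`** (a right action, e.g. the rational
representation `f ↦ f^*` of `End⁰(A)` on `H¹`): `[B : F]_red ≤ dim_F V`. [cite: MilneCM2006, Ch. I §1 Prop. 1.2 (p. 9)] -/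
theorem reducedDegree_le_finrank_of_injective_toEnd_mulOpposite {V : Type*} [AddCommGroup V] [Module F V]
    [FiniteDimensional F V] (ρ : B →ₐ[F] (Module.End F V)ᵐᵒᵖ) (hρ : Function.Injective ρ) :
    reducedDegree F B ≤ finrank F V := by
  let ρ' : Bᵐᵒᵖ →ₐ[F] Module.End F V :=
    ((AlgEquiv.opOp F (Module.End F V)).symm : (Module.End F V)ᵐᵒᵖᵐᵒᵖ →ₐ[F] Module.End F V).comp (AlgHom.op ρ)
  have hρ' : Function.Injective ρ' := by
    intro x y hxy
    have h1 : AlgHom.op ρ x = AlgHom.op ρ y := (AlgEquiv.opOp F (Module.End F V)).symm.injective hxy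
    have h2 : ρ (MulOpposite.unop x) = ρ (MulOpposite.unop y) := by
      simpa [AlgHom.op] using congrArg MulOpposite.unop h1
    exact MulOpposite.unop_injective (hρ h2)
  rw [← reducedDegree_mulOpposite]
  exact reducedDegree_le_finrank_of_injective_toEnd ρ' hρ'

omit [FiniteDimensional F B] in
/-- **Prop. 1.2 for a subalgebra `R ⊆ End_F(V)`: `[R : F]_red ≤ dim_F V`.** [cite: MilneCM2006, Ch. I §1 Prop. 1.2 (p. 9)] -/
theorem reducedDegree_le_finrank_of_le_end {V : Type*} [AddCommGroup V] [Module F V] [FiniteDimensional F V]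
    (R : Subalgebra F (Module.End F V)) : reducedDegree F R ≤ finrank F V :=
  reducedDegree_le_finrank_of_injective_toEnd R.val Subtype.val_injective

end Faithful

/-! ## §4 Products and commutative algebras -/

section Pi

variable {F : Type u} [Field F] {ι : Type w} [Fintype ι] {B : ι → Type v} [∀ i, Ring (B i)] [∀ i, Algebra F (B i)]
  [∀ i, FiniteDimensional F (B i)]

/-- The product of commutative reduced subalgebras `Lᵢ ⊆ Bᵢ` is a commutative reduced subalgebra of `∏ Bᵢ` of dimension
`Σ dim Lᵢ`. [folklore] -/
private theorem exists_pi_comm_isReduced (L : ∀ i, Subalgebra F (B i)) (hcomm : ∀ i, ∀ x ∈ L i, ∀ y ∈ L i, x * y = y * x)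
    (hred : ∀ i, IsReduced (L i)) :
    (∀ x ∈ Subalgebra.pi Set.univ L, ∀ y ∈ Subalgebra.pi Set.univ L, x * y = y * x) ∧
      IsReduced ↥(Subalgebra.pi Set.univ L) ∧
        finrank F ↥(Subalgebra.pi Set.univ L) = ∑ i, finrank F (L i) := by
  refine ⟨?_, ?_, ?_⟩
  · intro x hx y hy
    funext i
    exact hcomm i _ ((Subalgebra.mem_pi).1 hx i (Set.mem_univ i)) _ ((Subalgebra.mem_pi).1 hy i (Set.mem_univ i))
  · rw [isReduced_subalgebra_iff]
    intro x hx hn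
    funext i
    have hi := (isReduced_subalgebra_iff (L i)).1 (hred i) (x i) ((Subalgebra.mem_pi).1 hx i (Set.mem_univ i))
    exact hi (hn.map (Pi.evalRingHom B i))
  · let φ : ↥(Subalgebra.pi Set.univ L) ≃ₗ[F] (∀ i, L i) :=
      { toFun := fun x => fun i => ⟨(x : ∀ i, B i) i, (Subalgebra.mem_pi).1 x.2 i (Set.mem_univ i)⟩
        map_add' := fun x y => rfl
        map_smul' := fun c x => rfl
        invFun := fun y => ⟨fun i => (y i : B i), (Subalgebra.mem_pi).2 fun i _ => (y i).2⟩
        left_inv := fun x => rfl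
        right_inv := fun y => rfl }
    rw [φ.finrank_eq, Module.finrank_pi_fintype]

/-- The image of a commutative reduced subalgebra of `∏ Bᵢ` in the factor `Bᵢ` is commutative and reduced (a quotient
of a finite product of fields is a product of fields). [folklore] -/
private theorem isReduced_range_eval_comp_val (L : Subalgebra F (∀ i, B i)) (hcomm : ∀ x ∈ L, ∀ y ∈ L, x * y = y * x)
    [IsReduced L] (i : ι) :
    (∀ x ∈ ((Pi.evalAlgHom F B i).comp L.val).range, ∀ y ∈ ((Pi.evalAlgHom F B i).comp L.val).range,
        x * y = y * x) ∧ IsReduced ↥((Pi.evalAlgHom F B i).comp L.val).range := by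
  have hc : ∀ x ∈ ((Pi.evalAlgHom F B i).comp L.val).range, ∀ y ∈ ((Pi.evalAlgHom F B i).comp L.val).range,
      x * y = y * x := by
    rintro _ ⟨a, rfl⟩ _ ⟨b, rfl⟩
    rw [← map_mul, ← map_mul]
    exact congrArg _ (Subtype.ext (hcomm _ a.2 _ b.2))
  refine ⟨hc, ?_⟩
  letI : CommRing L := { (inferInstance : Ring L) with mul_comm := fun x y => Subtype.ext (hcomm x x.2 y y.2) }
  haveI : IsArtinianRing L := IsArtinianRing.of_finite F L
  haveI : IsSemisimpleRing L := IsArtinianRing.isSemisimpleRing_of_isReduced L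
  set R := ((Pi.evalAlgHom F B i).comp L.val).range
  letI : CommRing R := { (inferInstance : Ring R) with mul_comm := fun x y => Subtype.ext (hc x x.2 y y.2) }
  haveI : IsSemisimpleRing R :=
    RingHom.isSemisimpleRing_of_surjective ((Pi.evalAlgHom F B i).comp L.val).rangeRestrict.toRingHom
      (AlgHom.rangeRestrict_surjective _)
  infer_instance

/-- **`[∏ᵢ Bᵢ : F]_red = Σᵢ [Bᵢ : F]_red`** — the additivity of the reduced degree over the simple factors in Milne's
formula `[B:k]_red = Σᵢ [Bᵢ:kᵢ]^{1/2}[kᵢ:k]`. [cite: MilneCM2006, Ch. I §1 (1.2) (p. 9)] -/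
theorem reducedDegree_pi : reducedDegree F (∀ i, B i) = ∑ i, reducedDegree F (B i) := by
  classical
  apply le_antisymm
  · -- every commutative reduced `L ⊆ ∏ Bᵢ` embeds in `∏ᵢ πᵢ(L)`
    refine reducedDegree_le_iff.2 fun L hcomm hred => ?_
    let R : ∀ i, Subalgebra F (B i) := fun i => ((Pi.evalAlgHom F B i).comp L.val).range
    have hR : ∀ i, finrank F (R i) ≤ reducedDegree F (B i) := fun i => by
      obtain ⟨hc, hr⟩ := isReduced_range_eval_comp_val L hcomm i
      haveI := hr
      exact finrank_le_reducedDegree (R i) hc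
    let φ : L →ₗ[F] (∀ i, R i) :=
      { toFun := fun x => fun i => ⟨(x : ∀ i, B i) i, ⟨x, rfl⟩⟩
        map_add' := fun x y => rfl
        map_smul' := fun c x => rfl }
    have hφ : Function.Injective φ := by
      intro x y hxy
      apply Subtype.ext
      funext i
      exact congrArg (fun f : ∀ i, R i => ((f i : R i) : B i)) hxy
    calc finrank F L ≤ finrank F (∀ i, R i) := LinearMap.finrank_le_finrank_of_injective hφ
      _ = ∑ i, finrank F (R i) := Module.finrank_pi_fintype F
      _ ≤ ∑ i, reducedDegree F (B i) := Finset.sum_le_sum fun i _ => hR i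
  · -- the product of maximal ones
    choose L hcomm hred hdim using fun i => exists_finrank_eq_reducedDegree (F := F) (B := B i)
    obtain ⟨hc, hr, hd⟩ := exists_pi_comm_isReduced L hcomm hred
    haveI := hr
    calc ∑ i, reducedDegree F (B i) = ∑ i, finrank F (L i) := Finset.sum_congr rfl fun i _ => (hdim i).symm
      _ = finrank F ↥(Subalgebra.pi Set.univ L) := hd.symm
      _ ≤ reducedDegree F (∀ i, B i) := finrank_le_reducedDegree _ hc

end Pi

section Comm

variable {F : Type u} [Field F] {B : Type v} [Ring B] [Algebra F B] [FiniteDimensional F B]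

/-- **A commutative reduced algebra has `[B : F]_red = [B : F]`** (in Milne's formula: `Bᵢ = kᵢ`, `[Bᵢ:kᵢ]^{1/2} = 1`).
[cite: MilneCM2006, Ch. I §1 (1.2) (p. 9)] -/
theorem reducedDegree_eq_finrank_of_comm (hcomm : ∀ x y : B, x * y = y * x) [IsReduced B] :
    reducedDegree F B = finrank F B := by
  refine le_antisymm reducedDegree_le_finrank ?_
  haveI : IsReduced (⊤ : Subalgebra F B) :=
    (isReduced_subalgebra_iff ⊤).2 fun x _ hx => IsReduced.eq_zero x hx
  have h := finrank_le_reducedDegree (⊤ : Subalgebra F B) (fun x _ y _ => hcomm x y)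
  rwa [← Subalgebra.finrank_toSubmodule, Algebra.top_toSubmodule, finrank_top] at h

/-- In particular `[K : F]_red = [K : F]` for a finite extension field (or any commutative reduced algebra) `K ⊇ F`,
and `[F : F]_red = 1`. [cite: MilneCM2006, Ch. I §1 (1.2) (p. 9)] -/
theorem reducedDegree_self : reducedDegree F F = 1 := by
  rw [reducedDegree_eq_finrank_of_comm mul_comm, Module.finrank_self]

end Comm

/-! ## §5 Central simple algebras: `[B : F] = d²` ⟹ `[B : F]_red = d` -/

section CentralSimple

variable {F : Type u} [Field F] {B : Type v} [Ring B] [Algebra F B]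
  [Algebra.IsCentral F B] [IsSimpleRing B] [FiniteDimensional F B]

open scoped IsMulCommutative in
/-- **Central simple algebras: `[B : F] = d²` ⟹ `[B : F]_red = d`** («each degree `[Bᵢ:kᵢ]` is a square»; Prop. 1.3's
central simple case «every maximal subfield of `B` containing `k` has degree `[B:k]^{1/2}`», in max form).  Upper bound:
Bourbaki VIII §14 n°6 Prop. 3 (the tree's `finrank_le_of_finrank_eq_sq`: a commutative semisimple subalgebra has
`dim ≤ d`); attainment: n°7 Cor. 1 (the tree's `exists_isSeparable_comm_finrank_sq_eq`: an étale commutative `L` with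
`[L:F]² = [B:F]`).  Any field `F`.
[cite: MilneCM2006, Ch. I §1 (1.2) and Prop. 1.3 (p. 9)] [cite: BourbakiAlgebreVIII2012, VIII §14 n°6 Prop. 3, n°7 Cor. 1] -/
theorem reducedDegree_eq_of_isCentral_isSimple {d : ℕ} (hd : finrank F B = d ^ 2) : reducedDegree F B = d := by
  apply le_antisymm
  · refine reducedDegree_le_iff.2 fun L hcomm hred => ?_
    haveI : IsMulCommutative L := ⟨⟨fun x y => Subtype.ext (hcomm x x.2 y y.2)⟩⟩
    haveI : IsArtinianRing L := IsArtinianRing.of_finite F L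
    haveI : IsSemisimpleRing L := IsArtinianRing.isSemisimpleRing_of_isReduced L
    exact finrank_le_of_finrank_eq_sq L hd
  · obtain ⟨L, hcomm, -, hred, hsq⟩ := exists_isSeparable_comm_finrank_sq_eq (K := F) (B := B)
    haveI := hred
    have hL : finrank F L = d := Nat.pow_left_injective two_ne_zero (by simpa [hd] using hsq)
    exact hL ▸ finrank_le_reducedDegree L hcomm

end CentralSimple

section Matrix

variable {F : Type u} [Field F]

/-- **`[M_n(F) : F]_red = n`.** [cite: MilneCM2006, Ch. I §1 (1.2) (p. 9)] -/
theorem reducedDegree_matrix (n : Type w) [Fintype n] [DecidableEq n] [Nonempty n] :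
    reducedDegree F (Matrix n n F) = Fintype.card n :=
  reducedDegree_eq_of_isCentral_isSimple (by rw [Module.finrank_matrix, Module.finrank_self, mul_one, sq])

/-- **`[End_F(V) : F]_red = dim_F V`** (so the bound of Prop. 1.2 for the faithful module `V` of `End_F(V)` is sharp).
[cite: MilneCM2006, Ch. I §1 (1.2) and Prop. 1.2 (p. 9)] -/
theorem reducedDegree_moduleEnd (V : Type v) [AddCommGroup V] [Module F V] [FiniteDimensional F V] :
    reducedDegree F (Module.End F V) = finrank F V := by
  rcases subsingleton_or_nontrivial V with hV | hV
  · haveI : Subsingleton (Module.End F V) := ⟨fun f g => LinearMap.ext fun v => Subsingleton.elim _ _⟩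
    rw [reducedDegree_eq_zero_of_subsingleton, Module.finrank_zero_of_subsingleton]
  · have hn : 0 < finrank F V := finrank_pos
    haveI : Nonempty (Fin (finrank F V)) := ⟨⟨0, hn⟩⟩
    rw [reducedDegree_eq_of_algEquiv (LinearMap.toMatrixAlgEquiv (Module.finBasis F V)), reducedDegree_matrix,
      Fintype.card_fin]

end Matrix

/-! ## §6 Simple algebras over a bigger centre (characteristic `0`): `[B : K] = d²` ⟹ `[B : F]_red = d·[K : F]` -/

section OverCentre

variable {F : Type u} [Field F] {K : Type v} [Field K] [Algebra F K] [FiniteDimensional F K]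
  {B : Type w} [Ring B] [Algebra F B] [Algebra K B] [IsScalarTower F K B]
  [Algebra.IsCentral K B] [IsSimpleRing B] [FiniteDimensional K B]

open scoped IsMulCommutative in
/-- **Upper bound over a bigger centre**: for `B` central simple over `K ⊇ F` with `[B:K] = d²` and `F` of characteristic
`0`, every commutative reduced `F`-subalgebra `L ⊆ B` has `dim_F L ≤ d·[K:F]` — `L ⊆ K·L`, the image of `K ⊗_F L` (a
semisimple commutative algebra by Pierce §10.7, the tree's `isSemisimpleRing_baseChange`), a commutative semisimple
`K`-subalgebra, of `K`-dimension `≤ d` by §5. [cite: MilneCM2006, Ch. I §1 (1.2)–(1.3) (p. 9)] [cite: Pierce1982, §10.7 Cor. b] -/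
theorem finrank_le_mul_of_comm_isReduced [CharZero F] (L : Subalgebra F B)
    (hcomm : ∀ x ∈ L, ∀ y ∈ L, x * y = y * x) [IsReduced L] {d : ℕ} (hd : finrank K B = d ^ 2) :
    finrank F L ≤ d * finrank F K := by
  haveI : FiniteDimensional F B := Module.Finite.trans K B
  letI : CommRing L := { (inferInstance : Ring L) with mul_comm := fun x y => Subtype.ext (hcomm x x.2 y y.2) }
  haveI : IsArtinianRing L := IsArtinianRing.of_finite F L
  haveI : IsSemisimpleRing L := IsArtinianRing.isSemisimpleRing_of_isReduced L
  -- `K ⊗_F L` is semisimple (characteristic `0`)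
  haveI : IsSemisimpleRing (K ⊗[F] L) := SimpleModule.isSemisimpleRing_baseChange F L K
  -- the multiplication map `K ⊗_F L → B`, `a ⊗ x ↦ a·x`
  let φ : K ⊗[F] L →ₐ[K] B :=
    Algebra.TensorProduct.lift (Algebra.ofId K B) (L.val : L →ₐ[F] B)
      fun a x => Algebra.commute_algebraMap_left a (x : B)
  let R : Subalgebra K B := φ.range
  haveI : IsSemisimpleRing R :=
    RingHom.isSemisimpleRing_of_surjective φ.rangeRestrict.toRingHom (AlgHom.rangeRestrict_surjective φ)
  haveI : IsMulCommutative R := ⟨⟨by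
    rintro ⟨_, ⟨s, rfl⟩⟩ ⟨_, ⟨t, rfl⟩⟩
    exact Subtype.ext (by change φ s * φ t = φ t * φ s; rw [← map_mul, ← map_mul, mul_comm])⟩⟩
  have hRK : finrank K R ≤ d := finrank_le_of_finrank_eq_sq R hd
  -- `L ⊆ K·L` along an injective `F`-linear map
  have hmem : ∀ x ∈ L, x ∈ R := fun x hx =>
    ⟨(1 : K) ⊗ₜ[F] (⟨x, hx⟩ : L), by
      change φ ((1 : K) ⊗ₜ[F] (⟨x, hx⟩ : L)) = x
      rw [Algebra.TensorProduct.lift_tmul]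
      change algebraMap K B 1 * x = x
      rw [map_one, one_mul]⟩
  let ψ : L →ₗ[F] R :=
    { toFun := fun x => ⟨(x : B), hmem x x.2⟩
      map_add' := fun x y => rfl
      map_smul' := fun c x => Subtype.ext (by
        change ((c • x : L) : B) = c • ((x : B))
        rw [Subalgebra.coe_smul]) }
  have hψ : Function.Injective ψ := by
    intro x y hxy
    have h := congrArg Subtype.val hxy
    exact Subtype.ext h
  haveI : Module.Finite F R := Module.Finite.trans K R
  calc finrank F L ≤ finrank F R := LinearMap.finrank_le_finrank_of_injective hψ
    _ = finrank F K * finrank K R := (Module.finrank_mul_finrank F K R).symm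
    _ ≤ finrank F K * d := Nat.mul_le_mul_left _ hRK
    _ = d * finrank F K := mul_comm _ _

/-- **`[B : F]_red = d·[K : F]` for `B` central simple over a field `K ⊇ F` with `[B : K] = d²`** (`F` of characteristic
`0`) — the summand `[Bᵢ : kᵢ]^{1/2}[kᵢ : k]` of Milne's formula.  Attainment: a maximal étale `K`-subalgebra `L₀`
(`[L₀:K] = d`, §5) viewed over `F`. [cite: MilneCM2006, Ch. I §1 (1.2) and Prop. 1.3 (p. 9)] -/
theorem reducedDegree_eq_mul_of_isCentral_isSimple [CharZero F] {d : ℕ} (hd : finrank K B = d ^ 2) :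
    reducedDegree F B = d * finrank F K := by
  haveI : FiniteDimensional F B := Module.Finite.trans K B
  apply le_antisymm
  · exact reducedDegree_le_iff.2 fun L hcomm hred => finrank_le_mul_of_comm_isReduced L hcomm hd
  · obtain ⟨L₀, hcomm, -, hred, hsq⟩ := exists_isSeparable_comm_finrank_sq_eq (K := K) (B := B)
    have hL₀ : finrank K L₀ = d := Nat.pow_left_injective two_ne_zero (by simpa [hd] using hsq)
    let L : Subalgebra F B := L₀.restrictScalars F
    have hcommL : ∀ x ∈ L, ∀ y ∈ L, x * y = y * x := fun x hx y hy => hcomm x hx y hy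
    haveI : IsReduced L := by
      rw [isReduced_subalgebra_iff] at hred ⊢
      exact fun x hx hn => hred x hx hn
    have hdim : finrank F L = d * finrank F K := by
      have h1 : finrank F L = finrank F L₀ := rfl
      rw [h1, ← Module.finrank_mul_finrank F K L₀, hL₀, mul_comm]
    exact hdim ▸ finrank_le_reducedDegree L hcommL

end OverCentre

/-! ## §7 Milne's formula `[B : F]_red = Σᵢ [Bᵢ : kᵢ]^{1/2} [kᵢ : F]` -/

section Formula

variable {F : Type u} [Field F] [CharZero F] {B : Type v} [Ring B] [Algebra F B] [FiniteDimensional F B]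
  {ι : Type w} [Fintype ι]

/-- **MILNE'S DEFINITION AS A THEOREM: `[B : F]_red = Σᵢ [Bᵢ : kᵢ]^{1/2} [kᵢ : F]`** for every decomposition
`B ≃ ∏ᵢ Bᵢ` of a (semisimple) `F`-algebra into simple algebras `Bᵢ`, central over fields `kᵢ = Kᵢ ⊇ F`, with
`[Bᵢ : Kᵢ] = dᵢ²` (`F` of characteristic `0`). [cite: MilneCM2006, Ch. I §1 (1.2) (p. 9)] -/
theorem reducedDegree_eq_sum_of_algEquiv_pi {C : ι → Type*} {K : ι → Type*} [∀ i, Field (K i)]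
    [∀ i, Algebra F (K i)] [∀ i, FiniteDimensional F (K i)] [∀ i, Ring (C i)] [∀ i, Algebra F (C i)]
    [∀ i, Algebra (K i) (C i)] [∀ i, IsScalarTower F (K i) (C i)] [∀ i, Algebra.IsCentral (K i) (C i)]
    [∀ i, IsSimpleRing (C i)] [∀ i, FiniteDimensional (K i) (C i)] (e : B ≃ₐ[F] ∀ i, C i) {d : ι → ℕ}
    (hd : ∀ i, finrank (K i) (C i) = d i ^ 2) :
    reducedDegree F B = ∑ i, d i * finrank F (K i) := by
  haveI : ∀ i, FiniteDimensional F (C i) := fun i => Module.Finite.trans (K i) (C i)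
  rw [reducedDegree_eq_of_algEquiv e, reducedDegree_pi]
  exact Finset.sum_congr rfl fun i _ => reducedDegree_eq_mul_of_isCentral_isSimple (hd i)

/-- **Milne's formula in Wedderburn's shape: `[B : F]_red = Σᵢ nᵢ [Dᵢ : kᵢ]^{1/2} [kᵢ : F]`** for
`B ≃ ∏ᵢ M_{nᵢ}(Dᵢ)`, `Dᵢ` a central division algebra over the field `kᵢ = Kᵢ ⊇ F` with `[Dᵢ : Kᵢ] = δᵢ²` («Let
`B = ∏ Bᵢ`, where `Bᵢ ≈ M_{nᵢ}(Dᵢ)` with `Dᵢ` a central division algebra over `kᵢ` … `[B:k]_red = Σᵢ nᵢ[Dᵢ:k]^{1/2}[kᵢ:k]`»;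
`F` of characteristic `0`). [cite: MilneCM2006, Ch. I §1 (1.2) and proof of Prop. 1.2 (p. 9)] -/
theorem reducedDegree_eq_sum_of_algEquiv_pi_matrix {D : ι → Type*} {K : ι → Type*} [∀ i, Field (K i)]
    [∀ i, Algebra F (K i)] [∀ i, FiniteDimensional F (K i)] [∀ i, DivisionRing (D i)] [∀ i, Algebra F (D i)]
    [∀ i, Algebra (K i) (D i)] [∀ i, IsScalarTower F (K i) (D i)] [∀ i, Algebra.IsCentral (K i) (D i)]
    [∀ i, FiniteDimensional (K i) (D i)] (n : ι → ℕ) [∀ i, NeZero (n i)]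
    (e : B ≃ₐ[F] ∀ i, Matrix (Fin (n i)) (Fin (n i)) (D i)) {δ : ι → ℕ}
    (hδ : ∀ i, finrank (K i) (D i) = δ i ^ 2) :
    reducedDegree F B = ∑ i, n i * δ i * finrank F (K i) := by
  haveI : ∀ i, Nonempty (Fin (n i)) := fun i => ⟨⟨0, Nat.pos_of_ne_zero (NeZero.ne (n i))⟩⟩
  refine reducedDegree_eq_sum_of_algEquiv_pi (K := K) (C := fun i => Matrix (Fin (n i)) (Fin (n i)) (D i)) e
    (d := fun i => n i * δ i) fun i => ?_
  rw [Module.finrank_matrix, hδ i, Fintype.card_fin]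
  ring

end Formula

end Literature.RingTheory.CentralSimple
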